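import Summits.KontsevichZagierPeriods.KontsevichZagierPeriods.Theorems.HurwitzMicroSectorsNormalFormPrincipleDlogMoves

/-!
# `NormalFormPrinciple` (stmt-KontsevichZagierPeriods-3869), line `SketchIdeator1` — stub
# `exists_eq_carrier_sub`: a dlog representation is a difference of two carriers

The registered sub-goal `exists_eq_carrier_sub` of the dlog layer of the leaf `stub_boxRigidity`
(lead notes `Cruxes/NormalFormPrinciple/NOTES-c3.md`), verbatim: for rationals `0 < a < b` and
`c`, a representation `L = [(a,b), c/y]` is congruent, modulo `KZ.relations`, to the difference
`Λ(B,c) − Λ(A,c)` of two **carriers** `Λ(N,c) := [(1,N), c/y]`, where `b/a = B/A` with natural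
numbers `1 ≤ A < B`.

Proof ("certificate on the finite core"): the pair `(A, B)` is the explicit certificate
`((b/a).den, (b/a).num)` — reduced fraction of the rational `b/a > 1`, so `1 ≤ A < B` and
`b/a = B/A` are decided by the arithmetic of `ℚ` (`Rat.num_div_den`); then exactly two moves of
the landed engine `Theorems/HurwitzMicroSectorsNormalFormPrincipleDlogMoves.lean`:

* **scaling** (rule 2, dilation `y ↦ (A/a)·y`): `[(a,b), c/y] ≡ [(A,B), c/y]`
  (`Dlog.dlog_scale_mem_relations`);
* **splitting** (rule 1a at the point `A ∈ [1,B]`): `[(1,B), c/y] ≡ [(1,A), c/y] + [(A,B), c/y]`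
  (`Dlog.split_mem_relations`).

Sources: M. Kontsevich, D. Zagier, *Periods* (2001), §1.1 (`log 2 = ∫₁² dx/x`), §1.2 rules (1), (2).
No definitions are introduced; the carriers are quantified through the family `R` with its
domain/integrand description `hR`, exactly as in the registered signature.
-/

noncomputable section

open MeasureTheory Set
open Literature.NumberTheory.Transcendental Literature.NumberTheory.Transcendental.KZ

namespace Summit.KontsevichZagierPeriods.HurwitzMicroSectors.NormalFormPrinciple.PiBox.Dlog

namespace CarrierCertificate

/-- **The finite core (certificate).** For rationals `0 < a < b` the reduced fraction of `b/a`
gives natural numbers `A = (b/a).den`, `B = (b/a).num` with `1 ≤ A < B` and `b/a = B/A`.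
[folklore] -/
theorem exists_ratio_certificate {a b : ℚ} (ha : 0 < a) (hab : a < b) :
    ∃ A B : ℕ, 1 ≤ A ∧ A < B ∧ b / a = (B:ℚ) / A := by
  set q : ℚ := b / a with hq
  have hq1 : 1 < q := by
    rw [hq, lt_div_iff₀ ha, one_mul]
    exact hab
  have hnum0 : 0 ≤ q.num := Rat.num_nonneg.mpr (le_trans zero_le_one hq1.le)
  have hnd : q = (q.num : ℚ) / (q.den : ℚ) := (Rat.num_div_den q).symm
  have hden : (0:ℚ) < q.den := by exact_mod_cast q.den_pos
  have hlt : ((q.den : ℤ) : ℚ) < (q.num : ℚ) := by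
    rw [Int.cast_natCast]
    have h1 : (1:ℚ) < (q.num : ℚ) / (q.den : ℚ) := hnd ▸ hq1
    rwa [lt_div_iff₀ hden, one_mul] at h1
  have hlt' : (q.den : ℤ) < q.num := by exact_mod_cast hlt
  refine ⟨q.den, q.num.toNat, q.den_pos, ?_, ?_⟩
  · omega
  · have hB : ((q.num.toNat : ℕ) : ℚ) = (q.num : ℚ) := by
      rw [← Int.cast_natCast, Int.toNat_of_nonneg hnum0]
    rw [hB]
    exact hnd

/-- **Stub `exists_eq_carrier_sub`** (registered sub-goal of crux stmt-KontsevichZagierPeriods-3869,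
line `SketchIdeator1`, dlog layer). For rationals `0 < a < b` and `c`, the dlog representation
`L = [(a,b), c/y]` equals, in `FormalRep ⧸ relations`, the difference `[R 1 B c] − [R 1 A c]` of two
carriers `R 1 N c = [(1,N), c/y]`, where `(A, B)` is the certificate of `exists_ratio_certificate`
(`1 ≤ A < B`, `b/a = B/A`): one scaling move `[(a,b), c/y] ≡ [(A,B), c/y]` (dilation by `A/a`) and
one splitting move `[(1,B), c/y] ≡ [(1,A), c/y] + [(A,B), c/y]`.
[cite: KontsevichZagier2001, §1.2 rules (1), (2)] -/
theorem exists_eq_carrier_sub {R : ℚ → ℚ → ℚ → IntegralRep 1}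
    (hR : ∀ a b c, 0 < a → (R a b c).domain = {x | x 0 ∈ Set.Ioo (a:ℝ) b} ∧
      (R a b c).integrand = fun x => (c:ℝ) / x 0)
    {a b c : ℚ} (ha : 0 < a) (hab : a < b) (L : IntegralRep 1)
    (hd : L.domain = {x | x 0 ∈ Set.Ioo (a:ℝ) b})
    (hi : EqOn L.integrand (fun x => (c:ℝ) / x 0) L.domain) :
    ∃ A B : ℕ, 1 ≤ A ∧ A < B ∧ (b:ℝ) / a = B / A ∧
      QuotientAddGroup.mk' relations (of L) =
        QuotientAddGroup.mk' relations (of (R 1 B c)) -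
          QuotientAddGroup.mk' relations (of (R 1 A c)) := by
  obtain ⟨A, B, hA, hAB, hq⟩ := exists_ratio_certificate ha hab
  have hqR : (b:ℝ) / a = B / A := by
    have h := congrArg (fun t : ℚ => (t:ℝ)) hq
    simp only [Rat.cast_div, Rat.cast_natCast] at h
    exact h
  refine ⟨A, B, hA, hAB, hqR, ?_⟩
  -- the three carriers / slabs involved
  have hA0 : (0:ℚ) < A := by exact_mod_cast hA
  obtain ⟨hdAB, hiAB⟩ := hR A B c hA0
  obtain ⟨hd1B, hi1B⟩ := hR 1 B c one_pos
  obtain ⟨hd1A, hi1A⟩ := hR 1 A c one_pos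
  -- the scaling move `[(a,b), c/y] ≡ [(A,B), c/y]`, dilation factor `s = A/a`
  set s : ℚ := A / a with hs_def
  have hs : 0 < s := div_pos hA0 ha
  have hsa : s * a = A := by
    rw [hs_def]
    field_simp
  have hsb : s * b = B := by
    have hAq : (A:ℚ) ≠ 0 := hA0.ne'
    have hba : b = (B:ℚ) / A * a := by
      rw [← hq]
      field_simp
    rw [hs_def, hba]
    field_simp
  have h1 : of L - of (R A B c) ∈ relations :=
    dlog_scale_mem_relations (s := s) L (R A B c) hd (by rw [hsa, hsb]; exact hdAB) hi
      (fun x _ => by rw [hiAB]) ha hs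
  -- the splitting move `[(1,B), c/y] ≡ [(1,A), c/y] + [(A,B), c/y]`
  have h2 : of (R 1 B c) - of (R 1 A c) - of (R A B c) ∈ relations :=
    split_mem_relations (R 1 B c) (R 1 A c) (R A B c) hd1B hd1A hdAB (by exact_mod_cast hA)
      (by exact_mod_cast hAB.le) (fun x _ => by rw [hi1A, hi1B]) (fun x _ => by rw [hiAB, hi1B])
  -- bookkeeping in the quotient
  rw [← map_sub, QuotientAddGroup.mk'_apply, QuotientAddGroup.mk'_apply,
    QuotientAddGroup.eq_iff_sub_mem]
  have : of L - (of (R 1 B c) - of (R 1 A c)) =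
      (of L - of (R A B c)) - (of (R 1 B c) - of (R 1 A c) - of (R A B c)) := by abel
  rw [this]
  exact relations.sub_mem h1 h2

end CarrierCertificate

end Summit.KontsevichZagierPeriods.HurwitzMicroSectors.NormalFormPrinciple.PiBox.Dlog
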